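import Summits.AtomisticToContinuum.HydrodynamicLimit.Theorems.TwoClocksTransferEntropyClockTailRateChildren
import Summits.AtomisticToContinuum.HydrodynamicLimit.Theorems.AntiMazurCoboundariesKineticWindowGronwallPlusNode
import Summits.AtomisticToContinuum.HydrodynamicLimit.Theorems.OneFlightGossipEngineLocalClampedTransferLDAlongFamiliesSAxisNet
import HarnessLib

/-!
# Crux `TwoClocks.TransferEntropyClock` (stmt-AtomisticToContinuum-16625), line `tail-rate`: the kinetic child docks on the
# ONE KINETIC WALL of cruxes 9282 / 14443 / 16659 (support file, lead c6)

The line tail-rate closes the macroscopic clock `TwoClocks.TransferEntropyClock` modulo three children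
(`TransferEntropyClockTailRate.transferEntropyClock_of_tailRateChildren`, p145986):
`KCWUSharpPlus` (the numeric-threshold kinetic rung = crux 16659's registered stub), the local transfer family node
`LocalClampedTransferWindowLDFamily` (= item 17691) and `UGibbsSRBRigidity.GaussianTails` (= item 14415).

This file records in the kernel that the KINETIC child is implied by the bounds-uniform general-`F` local node
`KineticWindowGronwallPlusNode.KineticWindowLDBoundsUniform` — the wall behind crux 9282 (`KineticWindowGronwall`, its registered
stub `stub_kineticWindowLDBoundsUniform`), TwoClocks' crux 14443 (`localGibbsTransfer_of_plus`) and OneFlightGossipEngine's crux 16659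
(`kineticCurrentsLDAlongFamilies_of_uniform'`, p151107):

* `kcwuSharpPlus_of_boundsUniform : KineticWindowLDBoundsUniform → KCWUSharpPlus` — the structured class
  `A(x):w⊗w + (b(x)·w)G(x,|w|²) + K(x,|w|²)` of growth `C(1+‖v‖²)` is a continuous fast one-body functional; normalise by
  `C' := max C 1` and run the wall at tilt `β C'` with radius `β₀(Θ⁻¹, Θ, U, σ)/C'` (the activity bounds `Λ` are not needed: the wall's
  radius is uniform in the activity profile);
* `transferEntropyClock_of_kineticWall` — hence the crux by name from {the wall, the local transfer family node, GaussianTails};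
* `transferEntropyClock_of_threeWalls` — and from {the wall, crux 17691's single open stub `LCTSharp` (its s-axis net
  `LocalClampedTransferSketch.stub_sAxisNet` is landed, p147087), GaussianTails}.

So ONE kinetic statement (`KineticWindowLDBoundsUniform`), ONE collisional statement (`LCTSharp`) and ONE a-priori tail statement
(`GaussianTails`, itself closed modulo its propagation stub — `TransferEntropyClockInitialTails.stub_initialTails` p163416 and
`TransferEntropyClockTailToMoment.stub_tailToMoment` p163538 are landed) close the clocks of TwoClocks (16625), and the same kinetic
statement closes 14443, 16659 and (with its board inputs) 9282.

References: H.-T. Yau, Lett. Math. Phys. 22 (1991) §2; S. Olla, S. R. S. Varadhan, H.-T. Yau, Comm. Math. Phys. 155 (1993) §3.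
-/

noncomputable section

namespace Summit.AtomisticToContinuum.HydrodynamicLimit.Theorems.TransferEntropyClockKineticWall

open MeasureTheory Set Filter
open scoped ENNReal BigOperators
open Literature.Analysis.FluidPDE Literature.MathematicalPhysics.KineticTheory
open Summit.AtomisticToContinuum.HydrodynamicLimit.Theses
open Summit.AtomisticToContinuum.HydrodynamicLimit.Theorems.KineticWindowGronwallPlusNode (KineticWindowLDBoundsUniform mul_windowSum)
open Summit.AtomisticToContinuum.HydrodynamicLimit.Theorems.TransferEntropyClockTailRate (KCWUSharpPlus)
open Summit.AtomisticToContinuum.HydrodynamicLimit.Theorems.HydroLimitInBandOfHeart (LocalClampedTransferWindowLDFamily)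
open Summit.AtomisticToContinuum.HydrodynamicLimit.Theorems.LocalClampedTransferSketch (LCTSharp)

/-- **The bounds-uniform general-`F` kinetic node implies the numeric-threshold structured rung `KCWUSharpPlus`.**
Given data bounds `(Θ, U, C, Λ)` and `σ`, take the wall's radius `β₀ = β₀(Θ⁻¹, Θ, U, σ)` and answer with `β₀ / max C 1`: a member
`F = A:w⊗w + (b·w)G + K` of the structured class is continuous (its coefficients and `u₀` are), `F / max C 1` has growth
`≤ 1 + ‖v‖²` and inherits the three orthogonality relations, and `β · Σᵢ w⁻¹∫ F = (β max C 1) · Σᵢ w⁻¹∫ (F / max C 1)` pointwise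
(`mul_windowSum`). [folklore] -/
theorem kcwuSharpPlus_of_boundsUniform :
    KineticWindowGronwallPlusNode.KineticWindowLDBoundsUniform → TransferEntropyClockTailRate.KCWUSharpPlus := by
  intro hU
  obtain ⟨η₀, hη₀, H⟩ := hU
  refine ⟨η₀, hη₀, fun Θ U C Λ hΘ hU0 _hC hΛ σ hσ => ?_⟩
  have hΘ0 : 0 < Θ := lt_of_lt_of_le one_pos hΘ
  have hΘinv : Θ⁻¹ ≤ Θ := (inv_le_one_of_one_le₀ hΘ).trans hΘ
  obtain ⟨β₀, hβ₀, Hβ⟩ := H Θ⁻¹ Θ U (inv_pos.2 hΘ0) hΘinv hU0 σ hσ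
  set C' : ℝ := max C 1 with hC'def
  have hC'0 : 0 < C' := lt_of_lt_of_le one_pos (le_max_right _ _)
  have hCC' : C ≤ C' := le_max_left _ _
  refine ⟨β₀ / C', div_pos hβ₀ hC'0, ?_⟩
  intro a θ₀ u₀ ha hθ hu haΛ hθΘ huU hguard Φ A b G K hA hb hG hK F hF hFC hO1 hO2 hO3 β hβ ε hε
  -- positivity of the activity and the temperature bounds in the wall's format
  have hΛ0 : 0 < Λ := lt_of_lt_of_le one_pos hΛ
  have ha0 : ∀ x, 0 < a x := fun x => lt_of_lt_of_le (inv_pos.2 hΛ0) (haΛ x).1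
  have hθm : ∀ x, Θ⁻¹ ≤ θ₀ x := fun x => (hθΘ x).1
  have hθM : ∀ x, θ₀ x ≤ Θ := fun x => (hθΘ x).2
  -- the structured member is continuous
  have hFc : Continuous F := by
    have e : F = fun y : T3 × V3 =>
        (∑ j : Fin 3, ∑ k : Fin 3, A y.1 j k * ((y.2 - u₀ y.1) j * (y.2 - u₀ y.1) k)) +
          (∑ j : Fin 3, b y.1 j * (y.2 - u₀ y.1) j) * G (y.1, ‖y.2 - u₀ y.1‖ ^ 2) +
          K (y.1, ‖y.2 - u₀ y.1‖ ^ 2) := funext hF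
    rw [e]
    have hw : Continuous fun y : T3 × V3 => y.2 - u₀ y.1 := continuous_snd.sub (hu.comp continuous_fst)
    have hwj : ∀ j : Fin 3, Continuous fun y : T3 × V3 => (y.2 - u₀ y.1) j := fun j =>
      (PiLp.continuous_apply 2 (fun _ : Fin 3 => ℝ) j).comp hw
    have hn : Continuous fun y : T3 × V3 => (y.1, ‖y.2 - u₀ y.1‖ ^ 2) :=
      continuous_fst.prodMk ((continuous_norm.comp hw).pow 2)
    have hAjk : ∀ j k : Fin 3, Continuous fun y : T3 × V3 => A y.1 j k := fun j k =>
      ((continuous_apply k).comp ((continuous_apply j).comp hA)).comp continuous_fst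
    have hbj : ∀ j : Fin 3, Continuous fun y : T3 × V3 => b y.1 j := fun j =>
      (PiLp.continuous_apply 2 (fun _ : Fin 3 => ℝ) j).comp (hb.comp continuous_fst)
    refine ((continuous_finsetSum _ fun j _ => continuous_finsetSum _ fun k _ =>
      (hAjk j k).mul ((hwj j).mul (hwj k))).add
        ((continuous_finsetSum _ fun j _ => (hbj j).mul (hwj j)).mul (hG.comp hn))).add (hK.comp hn)
  -- normalisation
  set F' : T3 × V3 → ℝ := fun y => C'⁻¹ * F y with hF'def
  have hF'c : Continuous F' := continuous_const.mul hFc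
  have hF'b : ∀ y, |F' y| ≤ 1 + ‖y.2‖ ^ 2 := by
    intro y
    simp only [hF'def, abs_mul, abs_inv, abs_of_pos hC'0]
    have h1 : |F y| ≤ C' * (1 + ‖y.2‖ ^ 2) := (hFC y).trans (mul_le_mul_of_nonneg_right hCC' (by positivity))
    calc C'⁻¹ * |F y| ≤ C'⁻¹ * (C' * (1 + ‖y.2‖ ^ 2)) := mul_le_mul_of_nonneg_left h1 (inv_nonneg.2 hC'0.le)
      _ = 1 + ‖y.2‖ ^ 2 := by field_simp
  have hO1' : ∀ x, ∫ v, F' (x, v) * localMaxwellian 1 (θ₀ x) (u₀ x) v = 0 := by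
    intro x
    have e : (fun v => F' (x, v) * localMaxwellian 1 (θ₀ x) (u₀ x) v) =
        fun v => C'⁻¹ * (F (x, v) * localMaxwellian 1 (θ₀ x) (u₀ x) v) := by
      funext v; simp only [hF'def]; ring
    rw [e, integral_const_mul, hO1 x, mul_zero]
  have hO2' : ∀ x (j : Fin 3), ∫ v, F' (x, v) * v j * localMaxwellian 1 (θ₀ x) (u₀ x) v = 0 := by
    intro x j
    have e : (fun v => F' (x, v) * v j * localMaxwellian 1 (θ₀ x) (u₀ x) v) =
        fun v => C'⁻¹ * (F (x, v) * v j * localMaxwellian 1 (θ₀ x) (u₀ x) v) := by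
      funext v; simp only [hF'def]; ring
    rw [e, integral_const_mul, hO2 x j, mul_zero]
  have hO3' : ∀ x, ∫ v, F' (x, v) * ‖v‖ ^ 2 * localMaxwellian 1 (θ₀ x) (u₀ x) v = 0 := by
    intro x
    have e : (fun v => F' (x, v) * ‖v‖ ^ 2 * localMaxwellian 1 (θ₀ x) (u₀ x) v) =
        fun v => C'⁻¹ * (F (x, v) * ‖v‖ ^ 2 * localMaxwellian 1 (θ₀ x) (u₀ x) v) := by
      funext v; simp only [hF'def]; ring
    rw [e, integral_const_mul, hO3 x, mul_zero]
  -- run the wall at tilt `β C'`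
  have hβ' : |β * C'| ≤ β₀ := by
    rw [abs_mul, abs_of_pos hC'0]
    calc |β| * C' ≤ β₀ / C' * C' := mul_le_mul_of_nonneg_right hβ hC'0.le
      _ = β₀ := div_mul_cancel₀ β₀ hC'0.ne'
  obtain ⟨τ₀, hτ₀, Hτ⟩ := Hβ a θ₀ u₀ ha hθ hu ha0 hθm hθM huU hguard Φ F' hF'c hF'b hO1' hO2' hO3' (β * C')
    hβ' ε hε
  refine ⟨τ₀, hτ₀, fun τ hτ => ?_⟩
  obtain ⟨N₀, HN⟩ := Hτ τ hτ
  refine ⟨N₀, fun N hN => ?_⟩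
  have h := HN N hN
  refine le_of_eq_of_le (lintegral_congr fun z => ?_) h
  rw [mul_windowSum (Φ N) F β, mul_windowSum (Φ N) F' (β * C')]
  congr 2
  refine Finset.sum_congr rfl fun i _ => ?_
  congr 1
  refine intervalIntegral.integral_congr fun r _ => ?_
  simp only [hF'def]
  field_simp

/-- **The crux by name from the one kinetic wall, the local transfer family node and the Gaussian tails**
(`transferEntropyClock_of_tailRateChildren` fed `kcwuSharpPlus_of_boundsUniform`). [cite: Yau1991, §2] -/
theorem transferEntropyClock_of_kineticWall :
    KineticWindowLDBoundsUniform → LocalClampedTransferWindowLDFamily → UGibbsSRBRigidity.GaussianTails →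
      TwoClocks.TransferEntropyClock :=
  fun hU hL hG =>
    TransferEntropyClockTailRate.transferEntropyClock_of_tailRateChildren (kcwuSharpPlus_of_boundsUniform hU) hL hG

/-- **The crux by name from the three walls**: the one kinetic wall `KineticWindowLDBoundsUniform` (9282 / 14443 / 16659), crux
17691's single open stub `LCTSharp` (through its landed s-axis net `stub_sAxisNet`; 17691's decl is the same term as the heart's
local transfer family node) and item 14415 `GaussianTails`. [cite: Yau1991, §2] -/
theorem transferEntropyClock_of_threeWalls :
    KineticWindowLDBoundsUniform → LCTSharp → UGibbsSRBRigidity.GaussianTails → TwoClocks.TransferEntropyClock :=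
  fun hU hS hG =>
    transferEntropyClock_of_kineticWall hU
      (show LocalClampedTransferWindowLDFamily from LocalClampedTransferSketch.stub_sAxisNet hS) hG

/-- **The restated clock over the three walls**: the sub-problem Statement from the one kinetic wall, `LCTSharp`, `GaussianTails`
and the crux's two true-law tail antecedents. [cite: Yau1991, §2] -/
theorem hydrodynamicLimit_of_threeWalls :
    KineticWindowLDBoundsUniform → LCTSharp → UGibbsSRBRigidity.GaussianTails →
      TwoClocks.TransferActivityTails → TwoClocks.EnergyCurrentTails → _root_.HydrodynamicLimit :=
  fun hU hS hG h₇ h₆ =>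
    TransferEntropyClockTailRate.hydrodynamicLimit_of_tailRateChildren (kcwuSharpPlus_of_boundsUniform hU)
      (show LocalClampedTransferWindowLDFamily from LocalClampedTransferSketch.stub_sAxisNet hS) hG h₇ h₆

end Summit.AtomisticToContinuum.HydrodynamicLimit.Theorems.TransferEntropyClockKineticWall

end
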